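import Summits.SmoothPoincare4.SmoothPoincare4.Theorems.ConvexBisectionAcyclicBisectionExistsSeamTwistSignBoundaryDeriv
import Literature.Topology.FourManifolds.RegularDomainMaps
import HarnessLib

/-!
# Seam transport, ST4 (4b, local constancy): the page determinant of a smooth boundary map varies
# continuously along the flat part of `∂ Base g`
(wave 5, brick X3-3c of sub-node ST4 `node_ST4_twistSign` of node T3c-2 `node_seam_transport` of
stub `stub_T3_dualPresentation` (T3), line `modp-braid-orbits`, crux
`ConvexBisection.AcyclicBisectionExists`, item stmt-SmoothPoincare4-10508; registered sub-goal
`helper_pageDet_bdDeriv_continuousAt`)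

The boundary ambient differential `bdDeriv g G y` (`…SeamTwistSignBoundaryDeriv.lean`) of a map
`G : ∂ Base g → Base g` is built from `mfderiv`'s, i.e. from the PREFERRED CHARTS at `y`, which jump
from point to point; only its restriction to `T_y ∂ Base g` is intrinsic.  To see that the page
determinant `y ↦ pageDet g (bdDeriv g G y) y` is nevertheless continuous (at flat page points, where
the canonical page tangents `τ`, `iτ` ARE tangent to `∂ Base g`), this file extends `G` locally to an
honest smooth map of `ℝ⁴`:

* §1 `sliceΘ g p` — the half-slice chart of `Base g ⊂ ℝ⁴` at `p` (a local diffeomorphism `Θ` of `ℝ⁴`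
  straightening the base to a half-space); the chart of the boundary 3-manifold at `y₀` reads
  `tail ∘ Θ` (`chartAt_boundary_apply`);
* §2 `locRetr g y₀ = (chart at y₀)⁻¹ ∘ tail ∘ Θ : ℝ⁴ → ∂ Base g` — a smooth LOCAL RETRACTION onto the
  boundary near `y₀` (`locRetr_apply_val : locRetr (y) = y`), smooth on the open set `locDom g y₀`;
* §3 for `G` smooth near `y₀` the extension `Ĝ = val ∘ G ∘ locRetr` is `C^∞` on an open set of `ℝ⁴`,
  `d(val ∘ G)_y = dĜ_{y} ∘ d(val)_y` near `y₀` (`mfderiv_val_comp_eq_fderiv_locExt`), hence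
  `bdDeriv g G y X = dĜ_y X` on `T_y ∂ Base g` and **`y ↦ pageDet g (bdDeriv g G y) y` is continuous at
  every flat page point `y₀`** (`helper_pageDet_bdDeriv_continuousAt`) — so its sign is locally
  constant wherever it does not vanish.

Everything is proved; no named facts, no `sorry`.  References: J. M. Lee, *Introduction to Smooth
Manifolds* (2013), Thm. 5.11, Prop. 5.47 [LeeSmoothManifolds2013]; J. Milnor, *Morse theory* (1963),
Thm. 3.1 [Milnor1963].
-/

noncomputable section

set_option linter.dupNamespace false

open scoped Manifold ContDiff Topology ComplexConjugate

namespace Summit.SmoothPoincare4.SmoothPoincare4.Theorems.AcyclicBisectionExists.ModpBraidOrbits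

open Set Function Filter Complex
open Literature.Topology.FourManifolds Literature.Topology.FourManifolds.HandleAttachingMap
  Literature.Topology.FourManifolds.BoundaryManifold Literature.Topology.FourManifolds.LefschetzBase

variable {g : ℕ}

/-! ## §1 The half-slice chart of the base and the chart of its boundary -/

/-- **The half-slice chart of `Base g` at `p`**: the local diffeomorphism `Θ` of `ℝ⁴` underlying the
preferred chart of the regular sublevel set `Base g = {rho ≤ 1/4}` at `p` (`Base g` is
`{0 ≤ (Θ q)₀}` on its source). [cite: Milnor1963, Thm. 3.1] -/
def sliceΘ (g : ℕ) (p : Base g) :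
    OpenPartialHomeomorph (EuclideanSpace ℝ (Fin 4)) (EuclideanSpace ℝ (Fin 4)) :=
  ((RegularSublevel.halfSliceAtlas (isRegularLevel_rho g)).datum p).Θ

/-- `p` lies in the source of its half-slice chart. [folklore] -/
theorem mem_sliceΘ_source (p : Base g) : p.1 ∈ (sliceΘ g p).source :=
  (RegularSublevel.halfSliceAtlas (isRegularLevel_rho g)).mem_source p

/-- The half-slice chart is smooth on its source. [folklore] -/
theorem contMDiffOn_sliceΘ (p : Base g) :
    ContMDiffOn 𝓘(ℝ, EuclideanSpace ℝ (Fin 4)) 𝓘(ℝ, EuclideanSpace ℝ (Fin 4)) ∞ (sliceΘ g p)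
      (sliceΘ g p).source :=
  ((RegularSublevel.halfSliceAtlas (isRegularLevel_rho g)).datum p).contMDiffOn_toFun

/-- The source of the preferred chart of `Base g` at `p` is the trace of the source of `Θ`. [folklore] -/
theorem mem_chartAt_base_source_iff (p q : Base g) :
    q ∈ (chartAt (EuclideanHalfSpace 4) p).source ↔ q.1 ∈ (sliceΘ g p).source := Iff.rfl

/-- **The preferred chart of `Base g` at `p` reads `Θ`** (as a vector of `ℝ⁴`) on its source. [cite: Milnor1963, Thm. 3.1] -/
theorem chartAt_base_val {p q : Base g} (hq : q.1 ∈ (sliceΘ g p).source) :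
    (chartAt (EuclideanHalfSpace 4) p q).val = sliceΘ g p q.1 :=
  ((RegularSublevel.halfSliceAtlas (isRegularLevel_rho g)).datum p).modelHalf_chart_apply (p := p) hq

/-- The source of the chart of the boundary 3-manifold at `y₀`. [folklore] -/
theorem mem_chartAt_boundary_source_iff (y₀ y : (bBase g).carrier) :
    y ∈ (chartAt (EuclideanSpace ℝ (Fin 3)) y₀).source ↔ y.1.1 ∈ (sliceΘ g y₀.1).source := Iff.rfl

/-- **The chart of the boundary 3-manifold at `y₀` reads `tail ∘ Θ`** on its source. [cite: LeeSmoothManifolds2013, Thm. 5.11] -/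
theorem chartAt_boundary_apply {y₀ y : (bBase g).carrier} (hy : y.1.1 ∈ (sliceΘ g y₀.1).source) :
    chartAt (EuclideanSpace ℝ (Fin 3)) y₀ y = tail 3 (sliceΘ g y₀.1 y.1.1) := by
  show boundaryChart y₀ y = _
  rw [boundaryChart_apply, chartAt_base_val hy]

/-! ## §2 A smooth local retraction of `ℝ⁴` onto the boundary -/

/-- **The local retraction** `(chart at y₀)⁻¹ ∘ tail ∘ Θ : ℝ⁴ → ∂ Base g` (junk far from `y₀`).
[cite: LeeSmoothManifolds2013, Thm. 5.11] -/
def locRetr (g : ℕ) (y₀ : (bBase g).carrier) (q : EuclideanSpace ℝ (Fin 4)) : (bBase g).carrier :=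
  (chartAt (EuclideanSpace ℝ (Fin 3)) y₀).symm (tail 3 (sliceΘ g y₀.1 q))

/-- The domain of the local retraction: where `Θ` is defined and `tail ∘ Θ` lands in the chart target.
[folklore] -/
def locDom (g : ℕ) (y₀ : (bBase g).carrier) : Set (EuclideanSpace ℝ (Fin 4)) :=
  (sliceΘ g y₀.1).source ∩
    (fun q => tail 3 (sliceΘ g y₀.1 q)) ⁻¹' (chartAt (EuclideanSpace ℝ (Fin 3)) y₀).target

/-- `tail ∘ Θ` is smooth on the source of `Θ`. [folklore] -/
theorem contMDiffOn_tail_sliceΘ (y₀ : (bBase g).carrier) :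
    ContMDiffOn 𝓘(ℝ, EuclideanSpace ℝ (Fin 4)) (𝓡 3) ∞ (fun q => tail 3 (sliceΘ g y₀.1 q))
      (sliceΘ g y₀.1).source :=
  contMDiff_tail.comp_contMDiffOn (contMDiffOn_sliceΘ y₀.1)

/-- The domain of the local retraction is open. [folklore] -/
theorem isOpen_locDom (y₀ : (bBase g).carrier) : IsOpen (locDom g y₀) :=
  (contMDiffOn_tail_sliceΘ y₀).continuousOn.isOpen_inter_preimage (sliceΘ g y₀.1).open_source
    (chartAt (EuclideanSpace ℝ (Fin 3)) y₀).open_target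

/-- Points of the chart source lie in the domain of the local retraction (read in `ℝ⁴`). [folklore] -/
theorem val_mem_locDom {y₀ y : (bBase g).carrier} (hy : y.1.1 ∈ (sliceΘ g y₀.1).source) :
    y.1.1 ∈ locDom g y₀ := by
  refine ⟨hy, ?_⟩
  show tail 3 (sliceΘ g y₀.1 y.1.1) ∈ (chartAt (EuclideanSpace ℝ (Fin 3)) y₀).target
  rw [← chartAt_boundary_apply hy]
  exact (chartAt (EuclideanSpace ℝ (Fin 3)) y₀).map_source hy

/-- `y₀` itself lies in the domain (read in `ℝ⁴`). [folklore] -/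
theorem val_mem_locDom_self (y₀ : (bBase g).carrier) : y₀.1.1 ∈ locDom g y₀ :=
  val_mem_locDom (mem_sliceΘ_source y₀.1)

/-- **The local retraction is smooth on its domain.** [cite: LeeSmoothManifolds2013, Thm. 5.11] -/
theorem contMDiffOn_locRetr (y₀ : (bBase g).carrier) :
    ContMDiffOn 𝓘(ℝ, EuclideanSpace ℝ (Fin 4)) (𝓡 3) ∞ (locRetr g y₀) (locDom g y₀) :=
  (contMDiffOn_chart_symm (x := y₀)).comp ((contMDiffOn_tail_sliceΘ y₀).mono inter_subset_left)
    fun _ hq => hq.2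

/-- **The local retraction is a left inverse of the inclusion**: `locRetr y₀ (y) = y` for `y` in the
chart source. [cite: LeeSmoothManifolds2013, Thm. 5.11] -/
theorem locRetr_apply_val {y₀ y : (bBase g).carrier} (hy : y.1.1 ∈ (sliceΘ g y₀.1).source) :
    locRetr g y₀ y.1.1 = y := by
  rw [locRetr, ← chartAt_boundary_apply hy]
  exact (chartAt (EuclideanSpace ℝ (Fin 3)) y₀).left_inv hy

/-! ## §3 Local extensions of boundary maps and continuity of the page determinant -/

section LocExt

variable {G : (bBase g).carrier → Base g} {W : Set (bBase g).carrier} {y₀ : (bBase g).carrier}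

/-- The domain on which the local extension `val ∘ G ∘ locRetr` is smooth. [folklore] -/
def locExtDom (g : ℕ) (W : Set (bBase g).carrier) (y₀ : (bBase g).carrier) :
    Set (EuclideanSpace ℝ (Fin 4)) :=
  locDom g y₀ ∩ locRetr g y₀ ⁻¹' (W ∩ (chartAt (EuclideanSpace ℝ (Fin 3)) y₀).source)

/-- The domain of the local extension is open. [folklore] -/
theorem isOpen_locExtDom (hW : IsOpen W) : IsOpen (locExtDom g W y₀) :=
  (contMDiffOn_locRetr y₀).continuousOn.isOpen_inter_preimage (isOpen_locDom y₀)
    (hW.inter (chartAt (EuclideanSpace ℝ (Fin 3)) y₀).open_source)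

/-- Points of `W` in the chart source lie in the domain of the local extension (read in `ℝ⁴`).
[folklore] -/
theorem val_mem_locExtDom {y : (bBase g).carrier} (hyW : y ∈ W)
    (hy : y.1.1 ∈ (sliceΘ g y₀.1).source) : y.1.1 ∈ locExtDom g W y₀ := by
  refine ⟨val_mem_locDom hy, ?_⟩
  show locRetr g y₀ y.1.1 ∈ W ∩ (chartAt (EuclideanSpace ℝ (Fin 3)) y₀).source
  rw [locRetr_apply_val hy]
  exact ⟨hyW, hy⟩

/-- **The local extension `Ĝ = val ∘ G ∘ locRetr` is smooth** on its domain when `G` is smooth on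
`W`. [cite: LeeSmoothManifolds2013, Thm. 5.11] -/
theorem contDiffOn_locExt (hG : ContMDiffOn (𝓡 3) (𝓡∂ 4) ∞ G W) :
    ContDiffOn ℝ ∞ (fun q => ((G (locRetr g y₀ q)).1 : EuclideanSpace ℝ (Fin 4))) (locExtDom g W y₀) := by
  rw [← contMDiffOn_iff_contDiffOn]
  have h1 : ContMDiffOn 𝓘(ℝ, EuclideanSpace ℝ (Fin 4)) (𝓡∂ 4) ∞ (G ∘ locRetr g y₀) (locExtDom g W y₀) :=
    hG.comp ((contMDiffOn_locRetr y₀).mono inter_subset_left) fun _ hq => hq.2.1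
  exact (RegularSublevel.contMDiff_incl (isRegularLevel_rho g)).comp_contMDiffOn h1

/-- **The differential of `val ∘ G` through the local extension**: for `y ∈ W` in the chart source,
`d(val ∘ G)_y = dĜ_{y} ∘ ambient_y ∘ (u ↦ (0, u))`. [cite: LeeSmoothManifolds2013, Thm. 5.11] -/
theorem mfderiv_val_comp_eq_fderiv_locExt (hW : IsOpen W) (hG : ContMDiffOn (𝓡 3) (𝓡∂ 4) ∞ G W)
    {y : (bBase g).carrier} (hyW : y ∈ W) (hy : y.1.1 ∈ (sliceΘ g y₀.1).source) :
    mfderiv (𝓡 3) (𝓡 4) (fun y' => ((G y').1 : EuclideanSpace ℝ (Fin 4))) y =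
      (fderiv ℝ (fun q => ((G (locRetr g y₀ q)).1 : EuclideanSpace ℝ (Fin 4))) y.1.1).comp
        ((ambientCLM g y.1).comp (consZeroL 3)) := by
  have hdiff : DifferentiableAt ℝ (fun q => ((G (locRetr g y₀ q)).1 : EuclideanSpace ℝ (Fin 4))) y.1.1 :=
    ((contDiffOn_locExt hG).differentiableOn (by simp)).differentiableAt
      ((isOpen_locExtDom hW).mem_nhds (val_mem_locExtDom hyW hy))
  have h1 : HasMFDerivAt (𝓡 3) (𝓡 4)
      ((fun q => ((G (locRetr g y₀ q)).1 : EuclideanSpace ℝ (Fin 4))) ∘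
        fun y' : (bBase g).carrier => ((y'.1).1 : EuclideanSpace ℝ (Fin 4))) y
      ((fderiv ℝ (fun q => ((G (locRetr g y₀ q)).1 : EuclideanSpace ℝ (Fin 4))) y.1.1).comp
        ((ambientCLM g y.1).comp (consZeroL 3))) :=
    hdiff.hasFDerivAt.hasMFDerivAt.comp y (hasMFDerivAt_val_val y)
  have he : (fun y' => ((G y').1 : EuclideanSpace ℝ (Fin 4))) =ᶠ[𝓝 y]
      ((fun q => ((G (locRetr g y₀ q)).1 : EuclideanSpace ℝ (Fin 4))) ∘
        fun y' : (bBase g).carrier => ((y'.1).1 : EuclideanSpace ℝ (Fin 4))) := by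
    have hs : (chartAt (EuclideanSpace ℝ (Fin 3)) y₀).source ∈ 𝓝 y :=
      (chartAt (EuclideanSpace ℝ (Fin 3)) y₀).open_source.mem_nhds hy
    filter_upwards [hs] with y' hy'
    show ((G y').1 : EuclideanSpace ℝ (Fin 4)) = (G (locRetr g y₀ y'.1.1)).1
    rw [locRetr_apply_val hy']
  exact (h1.congr_of_eventuallyEq he).mfderiv

/-- **The boundary ambient differential is the derivative of the local extension on `T ∂ Base g`.**
[cite: LeeSmoothManifolds2013, Thm. 5.11] -/
theorem bdDeriv_eq_fderiv_locExt (hW : IsOpen W) (hG : ContMDiffOn (𝓡 3) (𝓡∂ 4) ∞ G W)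
    {y : (bBase g).carrier} (hyW : y ∈ W) (hy : y.1.1 ∈ (sliceΘ g y₀.1).source)
    {X : EuclideanSpace ℝ (Fin 4)} (hX : fderiv ℝ (rho g) y.1.1 X = 0) :
    bdDeriv g G y X = fderiv ℝ (fun q => ((G (locRetr g y₀ q)).1 : EuclideanSpace ℝ (Fin 4))) y.1.1 X := by
  rw [bdDeriv_apply, mfderiv_val_comp_eq_fderiv_locExt hW hG hyW hy]
  show fderiv ℝ (fun q => ((G (locRetr g y₀ q)).1 : EuclideanSpace ℝ (Fin 4))) y.1.1
    (ambient g y.1 (consZeroL 3 (tail 3 ((ambientEquiv g y.1).symm X)))) = _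
  rw [ambient_consZeroL_tail y hX]

/-- At a flat page point the canonical page tangents are tangent to `∂ Base g`. [folklore] -/
theorem fderiv_rho_pageVec_eq_zero {q : EuclideanSpace ℝ (Fin 4)} (hflat : ‖cx q‖ ^ 2 < 4) :
    fderiv ℝ (rho g) q (pageVec g q) = 0 ∧ fderiv ℝ (rho g) q (cplxJ (pageVec g q)) = 0 := by
  constructor
  · rw [fderiv_rho_apply_of_flat hflat, dPhi_pageVec, mul_zero, Complex.zero_re, mul_zero]
  · rw [fderiv_rho_apply_of_flat hflat, dPhi_cplxJ_pageVec, mul_zero, Complex.zero_re, mul_zero]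

/-- **Sub-goal `helper_pageDet_bdDeriv_continuousAt`, structured form: the page determinant of the
boundary ambient differential of a smooth boundary map is continuous at flat page points.**
[cite: LeeSmoothManifolds2013, Thm. 5.11] -/
theorem continuousAt_pageDet_bdDeriv (hW : IsOpen W) (hy₀ : y₀ ∈ W)
    (hG : ContMDiffOn (𝓡 3) (𝓡∂ 4) ∞ G W) (hflat : ‖cx y₀.1.1‖ ^ 2 < 4) :
    ContinuousAt (fun y : (bBase g).carrier => pageDet g (bdDeriv g G y) y.1.1) y₀ := by
  set Γ : EuclideanSpace ℝ (Fin 4) → EuclideanSpace ℝ (Fin 4) :=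
    fun q => ((G (locRetr g y₀ q)).1 : EuclideanSpace ℝ (Fin 4)) with hΓ
  -- the honest function of `ℝ⁴`
  have hΓc : ContinuousOn (fun q => fderiv ℝ Γ q) (locExtDom g W y₀) :=
    (contDiffOn_locExt hG).continuousOn_fderiv_of_isOpen (isOpen_locExtDom hW) (by simp)
  have hF : ContinuousOn (fun q => pageDet g (fderiv ℝ Γ q) q) (locExtDom g W y₀) :=
    continuousOn_pageDet_family hΓc continuousOn_id
  have hFat : ContinuousAt (fun q => pageDet g (fderiv ℝ Γ q) q) y₀.1.1 :=
    hF.continuousAt ((isOpen_locExtDom hW).mem_nhds (val_mem_locExtDom hy₀ (mem_sliceΘ_source y₀.1)))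
  have hval : Continuous fun y : (bBase g).carrier => ((y.1).1 : EuclideanSpace ℝ (Fin 4)) :=
    continuous_subtype_val.comp continuous_subtype_val
  have hcomp : ContinuousAt (fun y : (bBase g).carrier => pageDet g (fderiv ℝ Γ y.1.1) y.1.1) y₀ :=
    ContinuousAt.comp (f := fun y : (bBase g).carrier => ((y.1).1 : EuclideanSpace ℝ (Fin 4)))
      (x := y₀) hFat hval.continuousAt
  -- it agrees with the page determinant of `bdDeriv` near `y₀`
  refine hcomp.congr ?_
  have hflat_nhds : ∀ᶠ y : (bBase g).carrier in 𝓝 y₀, ‖cx y.1.1‖ ^ 2 < 4 :=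
    (hval.continuousAt).eventually (isOpen_lt (contDiff_cx.continuous.norm.pow 2) continuous_const
      |>.mem_nhds hflat)
  filter_upwards [hflat_nhds, hW.mem_nhds hy₀,
    (chartAt (EuclideanSpace ℝ (Fin 3)) y₀).open_source.mem_nhds (mem_chart_source _ y₀)] with y hyf hyW hy
  obtain ⟨h1, h2⟩ := fderiv_rho_pageVec_eq_zero (g := g) hyf
  show pageDet g (fderiv ℝ Γ y.1.1) y.1.1 = pageDet g (bdDeriv g G y) y.1.1
  unfold pageDet
  rw [bdDeriv_eq_fderiv_locExt hW hG hyW hy h1, bdDeriv_eq_fderiv_locExt hW hG hyW hy h2]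

end LocExt

/-- **Sub-goal `helper_pageDet_bdDeriv_continuousAt` of stub `stub_T3_dualPresentation`** (T3 ▸ T3c-2 ▸
ST4 `node_ST4_twistSign`, brick X3-3c; wave 5, lead c5): for a map `G : ∂ Base g → Base g` smooth on an
open set `W ∋ y₀` of the boundary 3-manifold and a flat page point `y₀` (`‖x(y₀)‖² < 4`), the page
determinant `y ↦ pageDet g (bdDeriv g G y) y` of its boundary ambient differential is continuous at
`y₀` (local extension of `G` to a smooth map of `ℝ⁴` through a half-slice chart). [cite: LeeSmoothManifolds2013, Thm. 5.11] -/
theorem helper_pageDet_bdDeriv_continuousAt : ∀ (g : ℕ) (G : (Literature.Topology.FourManifolds.LefschetzBase.bBase g).carrier → Literature.Topology.FourManifolds.LefschetzBase.Base g) (W : Set (Literature.Topology.FourManifolds.LefschetzBase.bBase g).carrier) (y₀ : (Literature.Topology.FourManifolds.LefschetzBase.bBase g).carrier), IsOpen W → y₀ ∈ W → ContMDiffOn (𝓡 3) (𝓡∂ 4) ∞ G W → ‖Literature.Topology.FourManifolds.LefschetzBase.cx y₀.1.1‖ ^ 2 < 4 → ContinuousAt (fun y : (Literature.Topology.FourManifolds.LefschetzBase.bBase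 g).carrier => Summit.SmoothPoincare4.SmoothPoincare4.Theorems.AcyclicBisectionExists.ModpBraidOrbits.pageDet g (Summit.SmoothPoincare4.SmoothPoincare4.Theorems.AcyclicBisectionExists.ModpBraidOrbits.bdDeriv g G y) y.1.1) y₀ :=
  fun _ _ _ _ hW hy₀ hG hflat => continuousAt_pageDet_bdDeriv hW hy₀ hG hflat

end Summit.SmoothPoincare4.SmoothPoincare4.Theorems.AcyclicBisectionExists.ModpBraidOrbits

end
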